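/-
Copyright: cell pub-balaban-gaps (YM BLITZ Y1, track G1), seat g1-p2 GEN 9 (unit `pub-balaban-gaps-g1-p2`).  Row (D4) NODE O,
the DICTIONARY from lit-balaban's TYPED body of print's (3.35) (`B9Eq335RegularityClasses.Reg335Cube`: «there exists a gauge
transformation u on □ such that U^u = e^{iηA}, and … |A| < O(1)Mα₀(L^jη)^{−1}, |∇^ηA| < O(1)Mα₀(L^jη)^{−2} on □») to the gauge hypotheses of
this lineage's Cor. 3.6-shape ENDs (`D4WalkBlockCovariantGaugeExpMultiLevel` ∕ `…Exp2…`: a site gauge `g` with two-sided inverse, row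
sums `≤ 1`, `g(y)U_μ(y)g⁻(y + e_μ) = e^{X_μ(y)}`, the inverse relation, and the (3.37)-shape row-sum windows on `X = iηA`), for the cube
`□ = the whole torus` read at ONE scale `ξ`.  §1 is carrier-generic (any normed algebra `𝔸`, any lattice `(S, T)`); §2 is the torus
box `Π[0,N_μ)` with `𝔸 = Matrix (Fin N) (Fin N) ℂ` in the `ℓ^∞`-OPERATOR norm (a MODEL CHOICE: print's `|·|` is the operator norm on
`ℂ^N`; with the `ℓ^∞`-operator norm the row-sum windows cost 1 and the unitarity clause `‖u‖, ‖u⁻¹‖ ≤ 1` reads «row sums ≤ 1» — the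
fibre-norm dictionary (ν) of the census, made explicit).  HONEST FRAMING: bookkeeping between two typed hypothesis shapes; the genuine
GEOMETRY of print (Ω′₀ ⊂ □ a cube of T_{L^{−j}}, the nested family inside it) is NOT modelled — here □ = T and the scale `ξ` is a
parameter; nothing of Bałaban's asserted; (D4) instance 0∕1; NOT BetaPertH, NOT continuum, NOT Clay.
-/
import Literature.MathematicalPhysics.QuantumFieldTheory.Balaban1983to89.B9Eq335RegularityClasses
import Literature.MathematicalPhysics.QuantumFieldTheory.Balaban1983to89.B9Eq369Product
import Summits.QuantumFields.BalabanUV.Gaps.D4WalkBlockExpWindow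
import Literature.MathematicalPhysics.QuantumFieldTheory.Balaban1983to89.B6MultiLevelTorusOperator

/-!
# `Gaps.D4WalkBlockReg335Dictionary` — from `Reg335Cube` ((3.35)'s typed body) to the gauge hypotheses `gUg⁻(· + e_μ) = e^{X}` with
# (3.37)-shape windows on `X` (cell pub-balaban-gaps, seat g1-p2 gen 9)

HONEST DEPENDENCY (cell pub-balaban, verbatim): continuum YM on T⁴ ⇐ BetaPertH ∧ nine spine estimates (0/9 proved);
BetaPertH ⇐ (D1) ∧ (D4) ∧ CAP+tail.

* §1 (generic `𝔸`, `S`, `T`; `e^{iηA} = NormedSpace.exp ((iη)•A)` is lit-balaban's `B9Eq369Product.val_fluct`): `val_gaugeTr`, **`gauge_data_of_reg335Cube`**: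
  `Reg335Cube T U η □ ξ C` on `□ = univ` ⟹ ∃ `g g⁻ : S → 𝔸`, `X : ι → S → 𝔸` with `gg⁻ = g⁻g = 1`, `‖g‖, ‖g⁻‖ ≤ 1`,
  `g(y)U_μ(y)g⁻(T_μ y) = exp (X_μ y)`, `g(T_μ y)U_μ(y)⁻¹g⁻(y) = exp (−X_μ y)`, `‖X_μ y‖ ≤ |η|Cξ⁻¹`, `‖X_μ x − X_μ(T_μ⁻¹x)‖ ≤ |η|²Cξ⁻²`.
* §2 (torus box, matrices in the `ℓ^∞`-operator norm): **`gaugeHyps_of_reg335Cube_torus`** — the same with ROW-SUM windows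
  (`rowSumNorm ≤ ‖·‖`, 61a) and row sums of `g`, `g⁻` at most `1`; **`weighted_of_scale`**: at `ξ` with `|η|Cξ⁻¹ ≤ a₀L^{−k}`,
  `|η|²Cξ⁻² ≤ a₁L^{−2k}` the windows take the LEVEL-WEIGHTED form `a₀L^{−lev y}`, `a₁L^{−2lev x}` of the ENDs (`lev ≤ k`).
Value: bookkeeping (the census's D-O2-3a ∕ (ν) items as a lemma); words of row (D4) UNCHANGED.

References: T. Bałaban, Comm. Math. Phys. **99** (1985) 389–434 [B9], (3.28) p. 395, (3.35)–(3.37) p. 396, Cor. 3.6 p. 408.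
-/

noncomputable section

namespace Summit.QuantumFields.BalabanUV.Gaps.D4WalkBlockReg335Dictionary

open Complex NormedSpace
open scoped Matrix
open Literature.MathematicalPhysics.QuantumFieldTheory.Balaban1983to89
open Literature.MathematicalPhysics.QuantumFieldTheory.Balaban1983to89.B9Eq39Adjoint (R covD fluct)
open Literature.MathematicalPhysics.QuantumFieldTheory.Balaban1983to89.B9Eq3117Current (gaugeTr)
open Literature.MathematicalPhysics.QuantumFieldTheory.Balaban1983to89.B9Eq335RegularityClasses (Reg335Cube)
open Literature.MathematicalPhysics.QuantumFieldTheory.Balaban1983to89.B9Eq369Product (val_fluct val_inv_fluct)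
open Literature.MathematicalPhysics.QuantumFieldTheory.Balaban1983to89.B4Reflection242 (boxDom)
open Literature.MathematicalPhysics.QuantumFieldTheory.Balaban1983to89.B6MultiLevelBoxOperator (N0)
open Literature.MathematicalPhysics.QuantumFieldTheory.Balaban1983to89.B6MultiLevelTorusOperator (TDomains tshift unitVec)
open Summit.QuantumFields.BalabanUV.Gaps.D4WalkBlockTransportAlgebra (rowSumNorm)
open Summit.QuantumFields.BalabanUV.Gaps.D4WalkBlockExpWindow (rowSumNorm_le_norm)

/-! ## §1. Generic: the data of `Reg335Cube` unpacked -/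

section Generic

variable {𝔸 : Type*} [NormedRing 𝔸] [NormedAlgebra ℂ 𝔸] [CompleteSpace 𝔸] {S : Type*} {ι : Type*} [Fintype ι] [LinearOrder ι]
variable (T : ι → Equiv.Perm S) (U : ι → S → 𝔸ˣ)

omit [NormedAlgebra ℂ 𝔸] [CompleteSpace 𝔸] [Fintype ι] [LinearOrder ι] in
/-- The value of the gauge transform `U^u(b) = u(b₋)U(b)u(b₊)⁻¹` ((3.28)). [cite: Balaban1985BackgroundPropagators, (3.28) p.395] -/
theorem val_gaugeTr (u : S → 𝔸ˣ) (μ : ι) (x : S) :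
    ((gaugeTr T u U μ x : 𝔸ˣ) : 𝔸) = (u x : 𝔸) * (U μ x : 𝔸) * (((u (T μ x))⁻¹ : 𝔸ˣ) : 𝔸) := by
  simp [gaugeTr]

omit [Fintype ι] [LinearOrder ι] in
/-- **(3.35)'s TYPED BODY UNPACKED** (cube `= univ`): a gauge `g = u`, `g⁻ = u⁻¹` with `‖g‖, ‖g⁻‖ ≤ 1`, the relations
`g(y)U_μ(y)g⁻(T_μy) = exp (X_μ y)`, `g(T_μy)U_μ(y)⁻¹g⁻(y) = exp (−X_μ y)` with `X = (iη)•A`, and the NORM windows `‖X_μ y‖ ≤ |η|Cξ⁻¹`,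
`‖X_μ x − X_μ(T_μ⁻¹x)‖ ≤ |η|²Cξ⁻²` (from «|A| < Cξ⁻¹», «|η⁻¹(A(x + e_μ) − A(x))| < Cξ⁻²» at the flat background).
[cite: Balaban1985BackgroundPropagators, (3.35) p.396, (3.28) p.395] -/
theorem gauge_data_of_reg335Cube {η ξ C : ℝ} (hη : η ≠ 0) (h : Reg335Cube T U η (Set.univ : Set S) ξ C) :
    ∃ (g gi : S → 𝔸) (X : ι → S → 𝔸),
      (∀ x, g x * gi x = 1) ∧ (∀ x, gi x * g x = 1) ∧ (∀ x, ‖g x‖ ≤ 1) ∧ (∀ x, ‖gi x‖ ≤ 1) ∧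
      (∀ μ y, g y * (U μ y : 𝔸) * gi (T μ y) = exp (X μ y)) ∧
      (∀ μ y, g (T μ y) * (((U μ y)⁻¹ : 𝔸ˣ) : 𝔸) * gi y = exp (-X μ y)) ∧
      (∀ μ y, ‖X μ y‖ ≤ |η| * C * ξ⁻¹) ∧
      (∀ μ x, ‖X μ x - X μ ((T μ).symm x)‖ ≤ |η| ^ 2 * C * (ξ ^ 2)⁻¹) := by
  obtain ⟨u, A, hu, hg, hA, hD⟩ := h
  refine ⟨fun x => (u x : 𝔸), fun x => (((u x)⁻¹ : 𝔸ˣ) : 𝔸), fun μ y => ((I * η : ℂ)) • A μ y, fun x => Units.mul_inv _,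
    fun x => Units.inv_mul _, fun x => (hu x (Set.mem_univ _)).1, fun x => (hu x (Set.mem_univ _)).2, fun μ y => ?_, fun μ y => ?_,
    fun μ y => ?_, fun μ x => ?_⟩
  · have e := congrArg (fun v : 𝔸ˣ => (v : 𝔸)) (hg μ y (Set.mem_univ _))
    simpa only [val_gaugeTr, val_fluct] using e
  · have e := congrArg (fun v : 𝔸ˣ => (((v⁻¹ : 𝔸ˣ)) : 𝔸)) (hg μ y (Set.mem_univ _))
    simp only [gaugeTr, mul_inv_rev, inv_inv, Units.val_mul, val_inv_fluct] at e
    simpa only [mul_assoc] using e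
  · have h1 := (hA μ y (Set.mem_univ _)).le
    calc ‖((I * η : ℂ)) • A μ y‖ ≤ ‖((I * η : ℂ))‖ * ‖A μ y‖ := norm_smul_le _ _
      _ = |η| * ‖A μ y‖ := by simp
      _ ≤ |η| * (C * ξ⁻¹) := mul_le_mul_of_nonneg_left h1 (abs_nonneg η)
      _ = |η| * C * ξ⁻¹ := by ring
  · -- the flat covariant derivative at z = T_μ⁻¹ x in direction μ is A(x) − A(T⁻¹x)
    have h1 := (hD μ μ ((T μ).symm x) (Set.mem_univ _)).le
    have ecov : covD T (fun _ _ => (1 : 𝔸ˣ)) μ (A μ) ((T μ).symm x) = A μ x - A μ ((T μ).symm x) := by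
      simp [covD]
    rw [ecov] at h1
    have hη' : ‖((η : ℂ))⁻¹‖ = |η|⁻¹ := by simp
    have h2 : ‖A μ x - A μ ((T μ).symm x)‖ ≤ |η| * (C * (ξ ^ 2)⁻¹) := by
      have h3 : ‖((η : ℂ))⁻¹ • (A μ x - A μ ((T μ).symm x))‖ = |η|⁻¹ * ‖A μ x - A μ ((T μ).symm x)‖ := by
        rw [norm_smul, hη']
      rw [h3] at h1
      have hpos : 0 < |η| := abs_pos.2 hη
      rwa [inv_mul_le_iff₀ hpos] at h1
    calc ‖((I * η : ℂ)) • A μ x - ((I * η : ℂ)) • A μ ((T μ).symm x)‖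
        = ‖((I * η : ℂ)) • (A μ x - A μ ((T μ).symm x))‖ := by rw [smul_sub]
      _ ≤ ‖((I * η : ℂ))‖ * ‖A μ x - A μ ((T μ).symm x)‖ := norm_smul_le _ _
      _ = |η| * ‖A μ x - A μ ((T μ).symm x)‖ := by simp
      _ ≤ |η| * (|η| * (C * (ξ ^ 2)⁻¹)) := mul_le_mul_of_nonneg_left h2 (abs_nonneg η)
      _ = |η| ^ 2 * C * (ξ ^ 2)⁻¹ := by ring

end Generic

/-! ## §2. The torus box with matrices in the `ℓ^∞`-operator norm: row-sum windows, level weights -/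

section Torus

open scoped Matrix.Norms.Operator

variable {d N : ℕ} {ℓ Mh k R : ℕ} {P : Fin (d + 1) → ℕ}

/-- **THE GAUGE HYPOTHESES OF THE COR. 3.6-SHAPE ENDs FROM `Reg335Cube` ON THE TORUS** (matrices normed by the `ℓ^∞`-operator norm,
cube `= T`, one scale `ξ`): `g`, `g⁻` with two-sided inverse and ROW SUMS `≤ 1`, the two gauge relations with `exp (±X)`, and row-sum
windows `Σ_c‖X_μ(y)_{ac}‖ ≤ |η|Cξ⁻¹`, `Σ_c‖(X_μ(x) − X_μ(x − e_μ))_{ac}‖ ≤ |η|²Cξ⁻²`. [cite: Balaban1985BackgroundPropagators, (3.35) p.396, Cor. 3.6 p.408] -/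
theorem gaugeHyps_of_reg335Cube_torus (U : Fin (d + 1) → ↥(boxDom (N0 ℓ Mh k P)) → (Matrix (Fin N) (Fin N) ℂ)ˣ) {η ξ C : ℝ}
    (hη : η ≠ 0)
    (h : Reg335Cube (fun ν => tshift (N0 ℓ Mh k P) (unitVec ν)) U η (Set.univ : Set ↥(boxDom (N0 ℓ Mh k P))) ξ C) :
    ∃ (g gi : ↥(boxDom (N0 ℓ Mh k P)) → Matrix (Fin N) (Fin N) ℂ) (X : Fin (d + 1) → ↥(boxDom (N0 ℓ Mh k P)) → Matrix (Fin N) (Fin N) ℂ),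
      (∀ x, g x * gi x = 1) ∧ (∀ x, gi x * g x = 1) ∧ (∀ x a, ∑ b, ‖gi x a b‖ ≤ 1) ∧ (∀ x a, ∑ b, ‖g x a b‖ ≤ 1) ∧
      (∀ ν y, g y * (U ν y : Matrix (Fin N) (Fin N) ℂ) * gi ((tshift (N0 ℓ Mh k P) (unitVec ν)) y) = exp (X ν y)) ∧
      (∀ ν y, g ((tshift (N0 ℓ Mh k P) (unitVec ν)) y) * (((U ν y)⁻¹ : (Matrix (Fin N) (Fin N) ℂ)ˣ) : Matrix (Fin N) (Fin N) ℂ) * gi y =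
        exp (-X ν y)) ∧
      (∀ ν y a, rowSumNorm (X ν y) a ≤ |η| * C * ξ⁻¹) ∧
      (∀ ν x a, rowSumNorm (X ν x - X ν ((tshift (N0 ℓ Mh k P) (unitVec ν)).symm x)) a ≤ |η| ^ 2 * C * (ξ ^ 2)⁻¹) := by
  obtain ⟨g, gi, X, hg, hgi, hng, hngi, hrel, hreli, hX0, hX1⟩ := gauge_data_of_reg335Cube _ U hη h
  refine ⟨g, gi, X, hg, hgi, fun x a => (rowSumNorm_le_norm (gi x) a).trans (hngi x), fun x a => (rowSumNorm_le_norm (g x) a).trans (hng x),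
    hrel, hreli, fun ν y a => (rowSumNorm_le_norm _ a).trans (hX0 ν y), fun ν x a => (rowSumNorm_le_norm _ a).trans (hX1 ν x)⟩

/-- **LEVEL-WEIGHTED FORM** (the ENDs' window shape): if the one-scale constants satisfy `|η|Cξ⁻¹ ≤ a₀L^{−k}` and `|η|²Cξ⁻² ≤ a₁L^{−2k}`
(e.g. `ξ = L^kη` with `a₀ = a₁ = C`), then since `lev ≤ k` the windows hold with the weights `a₀L^{−lev y}`, `a₁L^{−2lev x}`.
[cite: Balaban1985BackgroundPropagators, (3.35)–(3.37) p.396; Balaban1984PropagatorsII, (2.1) p.224] -/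
theorem weighted_of_scale (D : TDomains d ℓ Mh k P R) {X : Fin (d + 1) → ↥(boxDom (N0 ℓ Mh k P)) → Matrix (Fin N) (Fin N) ℂ}
    {w0 w1 a₀ a₁ : ℝ} (ha₀ : 0 ≤ a₀) (ha₁ : 0 ≤ a₁)
    (h0 : ∀ ν y a, rowSumNorm (X ν y) a ≤ w0) (h1 : ∀ ν x a, rowSumNorm (X ν x - X ν ((tshift (N0 ℓ Mh k P) (unitVec ν)).symm x)) a ≤ w1)
    (hw0 : w0 ≤ a₀ * ((((ℓ : ℝ) + 1) ^ k))⁻¹) (hw1 : w1 ≤ a₁ * ((((ℓ : ℝ) + 1) ^ k))⁻¹ ^ 2) :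
    (∀ ν y a, rowSumNorm (X ν y) a ≤ a₀ * ((((ℓ : ℝ) + 1) ^ D.lev y.1))⁻¹) ∧
    (∀ ν x a, rowSumNorm (X ν x - X ν ((tshift (N0 ℓ Mh k P) (unitVec ν)).symm x)) a ≤ a₁ * ((((ℓ : ℝ) + 1) ^ D.lev x.1))⁻¹ ^ 2) := by
  have hL1 : (1 : ℝ) ≤ (ℓ : ℝ) + 1 := by linarith [(Nat.cast_nonneg ℓ : (0 : ℝ) ≤ ℓ)]
  have hmono : ∀ y : ↥(boxDom (N0 ℓ Mh k P)), ((((ℓ : ℝ) + 1) ^ k))⁻¹ ≤ ((((ℓ : ℝ) + 1) ^ D.lev y.1))⁻¹ := fun y =>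
    inv_anti₀ (by positivity) (pow_le_pow_right₀ hL1 (D.lev_le y.1))
  refine ⟨fun ν y a => (h0 ν y a).trans (hw0.trans (mul_le_mul_of_nonneg_left (hmono y) ha₀)), fun ν x a =>
    (h1 ν x a).trans (hw1.trans (mul_le_mul_of_nonneg_left ?_ ha₁))⟩
  exact pow_le_pow_left₀ (by positivity) (hmono x) 2

end Torus

end Summit.QuantumFields.BalabanUV.Gaps.D4WalkBlockReg335Dictionary

end
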